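import Mathlib
import HarnessLib
import Summits.AtomisticToContinuum.FouriersLaw.Theses.JunctionLocality
import Summits.AtomisticToContinuum.FouriersLaw.Theses.StaticAbelianSqueeze
import Summits.AtomisticToContinuum.FouriersLaw.Theorems.JunctionLocalityConductanceLowerBoundStubBulkAbelFloorOfHeatVarianceBets
import Summits.AtomisticToContinuum.FouriersLaw.Theorems.JunctionLocalityNonBallisticStubInfiniteVolumeWitness
import Summits.AtomisticToContinuum.FouriersLaw.Theorems.FourierGreenKuboFourierFiniteResponseOfUnique
import Literature.MathematicalPhysics.KineticTheory.LangevinChainNESSHolds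

/-!
# Crux `ConductanceLowerBound` (item stmt-AtomisticToContinuum-11749), line `abel-floor-exchange`:
# the CONVERSES — (A⁻) is necessary modulo (R), and (A⁻) is exactly the bulk Abel floor

Support file (`--supports stmt-AtomisticToContinuum-11749`; closes nothing; lead c7 of the line).

The registered skeleton of the line (`Cruxes/ConductanceLowerBound/Lines/abel_floor_exchange.lean`, sha `c884af29…`) proves the
crux from two stubs: (A⁻) `stub_openChainAbelFloor` (a fixed-frequency, `N`-uniform Abel floor `a·N ≤ F_N(ν) = ∫₀^∞e^{−νt}c_N` of the
open chain's equilibrium total-current autocorrelation `c_N`) and (R⁻) `stub_signedSlowRegularity` (the lower half of the sibling item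
(R) `StaticAbelianSqueeze.UniformAbelianRegularity`, stmt-AtomisticToContinuum-13416).  The landed bridges
(`abelFloor_openChain_of_bulkWitness`, `slowRegularity_signed_of_uniformAbelianRegularity`,
`conductanceLowerBound_of_abelFloor_and_signedSlowRegularity`, p156938) give `W ⟹ (A⁻)` and `(A⁻) ∧ (R⁻) ⟹ crux`, where `W` is the
SHIFT-INVARIANT BULK ABEL-FLOOR WITNESS: a shift-invariant DLR state `μ_T`, a `μ_T`-preserving infinite-volume dynamics with absolutely
convergent summed current correlations `C_T`, and `a, ν₀ > 0` with `a ≤ Â(ν) := ∫₀^∞ e^{−νt} C_T(t) dt` for `ν ∈ (0, ν₀)`.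

This file closes the circle, so that the hand-back of (A⁻) to the planners is EXACT (nothing weaker would do, nothing stronger is asked):

* `abelFloor_openChain_of_conductanceLowerBound_of_uniformAbelianRegularity` — **(R) → crux → (A⁻)**: along the canonical unique
  steady-state family, (K) `(N−1)T²D_N = ∫₀^∞c_N = F_N(ν) + I_N(ν)` (`kuboAbelIdentity_holds`, `integral_abelSplit`), the crux
  `D_N ≥ c` and (R) `|I_N(ν)| ≤ (cT²/4)·N` give `F_N(ν) ≥ (N−1)T²c − cT²N/4 ≥ (cT²/4)·N` for `N ≥ 2`.  So modulo the sibling (R) the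
  stub (A⁻) is NECESSARY for the crux: promoting it loses nothing.
* `bulkAbelFloorWitness_of_abelFloor_openChain` — **(A⁻) → W**: the tree holds an unconditional regular witness
  (`NonBallistic.stub_infiniteVolumeWitness`, p143465: shift-invariant superstable DLR state, Buttà–Marchioro dynamics on `bmGood`,
  absolutely convergent correlations), and the landed fixed-frequency matching S3 (`fixedFrequencyMatching_of_registeredLeaves` with its
  two landed leaves and `stub_regularDLRUnique`) gives `F_N(ν)/N → Â(ν)` at it; `F_N(ν) ≥ aN` eventually forces `Â(ν) ≥ a`.
* `abelFloor_openChain_iff_bulkAbelFloorWitness` — **(A⁻) ↔ W**: the registered stub IS the infinite-volume statement "the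
  Abel-regularised Green–Kubo integral of the shift-invariant Gibbs bulk is bounded below for small `ν`" (energy spread at least
  diffusive in Abel mean; no Abel-insulating bulk).
* `conductanceLowerBound_iff_bulkAbelFloorWitness_of_uniformAbelianRegularity` — **under (R): crux ↔ W**.  On every route that files
  the sibling stmt-13416 (StaticAbelianSqueeze, CageBudgetFekete, EmbeddedDrudeMourre, CoercivePulse, HoelderEscapeProfile,
  LatticeLandauDamping), the shared child stmt-11749 is therefore EXACTLY the bulk Abel floor `W` — the statement the line recommends
  promoting to a shared item ("BulkAbelFloorSI"), with both directions of the glue kernel-checked here and in p156938.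

References: Kundu–Dhar–Narayan 2009 (open-system Green–Kubo); Bonetto–Lebowitz–Rey-Bellet 2000 §7 (infinite-volume Green–Kubo);
Buttà–Marchioro 2016 (infinite dynamics).  No definitions, no named facts, no sorry.
-/

noncomputable section

open MeasureTheory Filter Set Topology
open Literature.MathematicalPhysics.KineticTheory.HeatConduction
open Summit.AtomisticToContinuum.FouriersLaw.Theorems
open Summit.AtomisticToContinuum.FouriersLaw.Theorems.AbelThermodynamicLimit.SeriesLawAtEveryLaplaceFrequency

namespace Summit.AtomisticToContinuum.FouriersLaw.Cruxes.ConductanceLowerBound.AbelFloorExchange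

/-! ## §1 (A⁻) is necessary modulo (R) -/

/-- **(R) → crux → (A⁻).**  If `UniformAbelianRegularity` (stmt-13416) and `ConductanceLowerBound` hold then the open chain's
Abel-regularised Green–Kubo integral has an `N`-uniform floor at every small fixed frequency: `(cT²/4)·N ≤ F_N(ν)` eventually in `N`,
for `ν ∈ (0, ν₀)`.  Proof: canonical steady-state family (existence + weak-NESS uniqueness, both landed), its response coefficients
(`finiteResponse_of_unique`), the Kubo identity (K) and the Abelian split, then `F_N = ∫c_N − I_N ≥ (N−1)T²c − cT²N/4`.
[cite: KunduDharNarayan2009, p. 3] -/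
theorem abelFloor_openChain_of_conductanceLowerBound_of_uniformAbelianRegularity
    (hR : Summit.AtomisticToContinuum.FouriersLaw.Theses.StaticAbelianSqueeze.UniformAbelianRegularity)
    (hC : Summit.AtomisticToContinuum.FouriersLaw.Theses.JunctionLocality.ConductanceLowerBound) :
    ∀ ω₂ lam β γ : ℝ, 0 < ω₂ → 0 < lam → 0 < β → 0 < γ → ∀ T : ℝ, 0 < T →
      ∃ a : ℝ, 0 < a ∧ ∃ ν₀ : ℝ, 0 < ν₀ ∧ ∀ ν : ℝ, 0 < ν → ν < ν₀ → ∃ N₀ : ℕ, ∀ N : ℕ, N₀ ≤ N →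
        a * N ≤ ∫ t in Set.Ioi (0:ℝ), Real.exp (-(ν * t)) *
          ∫ z, (∑ i : Fin N, (pinnedChain ω₂ lam β γ).bondCurrent N i z) *
            (∫ y, (∑ i : Fin N, (pinnedChain ω₂ lam β γ).bondCurrent N i y)
              ∂((pinnedChain ω₂ lam β γ).transitionKernel N T T t.toNNReal z))
            ∂((pinnedChain ω₂ lam β γ).gibbsMeasure N T) := by
  intro ω₂ lam β γ hω hl hβ hγ T hT
  -- the canonical steady-state family
  let μ : (N : ℕ) → ℝ → ℝ → Measure (PhaseSpace N) := fun N a b =>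
    if hab : 0 < a ∧ 0 < b then
      Classical.choose (pinnedChain_exists_isSteadyState hω hl hβ hγ N hab.1 hab.2)
    else 0
  have hμ : ∀ (N : ℕ) (T_L T_R : ℝ), 0 < T_L → 0 < T_R →
      (pinnedChain ω₂ lam β γ).IsSteadyState N T_L T_R (μ N T_L T_R) := by
    intro N T_L T_R hL hR'
    show (pinnedChain ω₂ lam β γ).IsSteadyState N T_L T_R
      (if hab : 0 < T_L ∧ 0 < T_R then
        Classical.choose (pinnedChain_exists_isSteadyState hω hl hβ hγ N hab.1 hab.2) else 0)
    rw [dif_pos ⟨hL, hR'⟩]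
    exact Classical.choose_spec (pinnedChain_exists_isSteadyState hω hl hβ hγ N hL hR')
  have hU : ∀ (N : ℕ) (T_L T_R : ℝ), 0 < T_L → 0 < T_R → ∀ ρ ρ' : Measure (PhaseSpace N),
      (pinnedChain ω₂ lam β γ).IsSteadyState N T_L T_R ρ →
      (pinnedChain ω₂ lam β γ).IsSteadyState N T_L T_R ρ' → ρ = ρ' :=
    Summit.AtomisticToContinuum.FouriersLaw.Theses.JunctionLocality.NessUnique_holds ω₂ lam β γ hω hl hβ hγ
  -- its response coefficients exist
  have hDex := FourierGreenKubo.finiteResponse_of_unique ω₂ lam β γ hω hl hβ hγ hU μ hμ T hT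
  choose Dn hDn using hDex
  obtain ⟨c, hc, N₁, hcD⟩ := hC ω₂ lam β γ hω hl hβ hγ hU μ hμ T hT Dn hDn
  -- (R) at `ε = c T² / 4`
  obtain ⟨ν₀, hν₀, hRν⟩ := hR ω₂ lam β γ hω hl hβ hγ T hT (c * T ^ 2 / 4) (by positivity)
  refine ⟨c * T ^ 2 / 4, by positivity, ν₀, hν₀, fun ν hν hlt => ?_⟩
  obtain ⟨N₂, hN₂⟩ := hRν ν hν hlt
  refine ⟨max (max N₁ N₂) 2, fun N hN => ?_⟩
  have hN1 : N₁ ≤ N := le_trans (le_trans (le_max_left _ _) (le_max_left _ _)) hN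
  have hN2 : N₂ ≤ N := le_trans (le_trans (le_max_right _ _) (le_max_left _ _)) hN
  have hN3 : 2 ≤ N := le_trans (le_max_right _ _) hN
  -- the finite-chain autocorrelation as a named function
  obtain ⟨cc, hcc⟩ : ∃ cc : ℕ → ℝ → ℝ, cc = fun (N : ℕ) (t : ℝ) =>
      ∫ z, (∑ i : Fin N, (pinnedChain ω₂ lam β γ).bondCurrent N i z) *
        (∫ y, (∑ i : Fin N, (pinnedChain ω₂ lam β γ).bondCurrent N i y)
          ∂((pinnedChain ω₂ lam β γ).transitionKernel N T T t.toNNReal z))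
        ∂((pinnedChain ω₂ lam β γ).gibbsMeasure N T) := ⟨_, rfl⟩
  have hK : IntegrableOn (cc N) (Ioi 0) ∧ ((N : ℝ) - 1) * T ^ 2 * Dn N = ∫ t in Ioi (0 : ℝ), cc N t := by
    simpa only [hcc] using
      StaticAbelianSqueeze.kuboAbelIdentity_holds ω₂ lam β γ hω hl hβ hγ hU μ hμ T hT N (Dn N) (hDn N)
  have hI : |∫ t in Ioi (0:ℝ), (1 - Real.exp (-(ν * t))) * cc N t| ≤ c * T ^ 2 / 4 * N := by
    simpa only [hcc] using hN₂ N hN2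
  have hsplit := integral_abelSplit (cc N) ν hν hK.1
  have hcN : c ≤ Dn N := hcD N hN1
  have hNge : (2:ℝ) ≤ N := by exact_mod_cast hN3
  have hnn : 0 ≤ ((N:ℝ) - 1) * T ^ 2 := mul_nonneg (by linarith) (by positivity)
  have hA : ((N:ℝ) - 1) * T ^ 2 * c ≤ ∫ t in Ioi (0:ℝ), cc N t := by
    rw [← hK.2]; exact mul_le_mul_of_nonneg_left hcN hnn
  have hI' := (abs_le.mp hI).2
  have hB : 0 ≤ T ^ 2 * c := by positivity
  have key : T ^ 2 * c * 2 ≤ T ^ 2 * c * N := mul_le_mul_of_nonneg_left hNge hB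
  have e1 : ((N:ℝ) - 1) * T ^ 2 * c = T ^ 2 * c * N - T ^ 2 * c := by ring
  have e2 : c * T ^ 2 / 4 * (N:ℝ) = T ^ 2 * c * N / 4 := by ring
  rw [e1, hsplit] at hA
  rw [e2] at hI'
  have goal : T ^ 2 * c * N / 4 ≤ ∫ t in Ioi (0:ℝ), Real.exp (-(ν * t)) * cc N t := by linarith
  rw [e2]
  simpa only [hcc] using goal

/-! ## §2 (A⁻) is exactly the shift-invariant bulk Abel floor -/

/-- **(A⁻) → W.**  If the open chains have an `N`-uniform fixed-frequency Abel floor, then at the tree's unconditional regular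
witness (`NonBallistic.stub_infiniteVolumeWitness`: shift-invariant superstable DLR state `μ_T`, Buttà–Marchioro dynamics on
`bmGood` preserving `μ_T`, absolutely convergent summed current correlations) the bulk Abel integral obeys `a ≤ ∫₀^∞e^{−νt}C_T`
for `ν ∈ (0, ν₀)`: by the landed fixed-frequency matching S3, `F_N(ν)/N → Â(ν)`, and `F_N(ν)/N ≥ a` eventually.
[cite: BonettoLebowitzReyBellet2000, §7 eq. (37)] -/
theorem bulkAbelFloorWitness_of_abelFloor_openChain
    (hA : ∀ ω₂ lam β γ : ℝ, 0 < ω₂ → 0 < lam → 0 < β → 0 < γ → ∀ T : ℝ, 0 < T →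
      ∃ a : ℝ, 0 < a ∧ ∃ ν₀ : ℝ, 0 < ν₀ ∧ ∀ ν : ℝ, 0 < ν → ν < ν₀ → ∃ N₀ : ℕ, ∀ N : ℕ, N₀ ≤ N →
        a * N ≤ ∫ t in Set.Ioi (0:ℝ), Real.exp (-(ν * t)) *
          ∫ z, (∑ i : Fin N, (pinnedChain ω₂ lam β γ).bondCurrent N i z) *
            (∫ y, (∑ i : Fin N, (pinnedChain ω₂ lam β γ).bondCurrent N i y)
              ∂((pinnedChain ω₂ lam β γ).transitionKernel N T T t.toNNReal z))
            ∂((pinnedChain ω₂ lam β γ).gibbsMeasure N T)) :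
    ∀ ω₂ lam β γ : ℝ, 0 < ω₂ → 0 < lam → 0 < β → 0 < γ → ∀ T : ℝ, 0 < T →
      ∃ (μT : Measure ChainConfig) (D : InfiniteChainDynamics (pinnedChain ω₂ lam β γ)) (a ν₀ : ℝ),
        (pinnedChain ω₂ lam β γ).IsChainGibbsMeasure T μT ∧ IsShiftInvariant μT ∧
        D.PreservesMeasure μT ∧ (∀ t : ℝ, D.HasAbsConvergentCorrelation μT t) ∧ 0 < a ∧ 0 < ν₀ ∧
        ∀ ν : ℝ, 0 < ν → ν < ν₀ →
          a ≤ ∫ t in Set.Ioi (0:ℝ), Real.exp (-(ν * t)) * D.currentCorrelation μT t := by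
  intro ω₂ lam β γ hω hl hβ hγ T hT
  obtain ⟨μT, D, hG, hS, -, hcar, hP, -, hAC⟩ :=
    NonBallistic.stub_infiniteVolumeWitness ω₂ lam β γ hω hl hβ hγ T hT
  haveI : IsProbabilityMeasure μT := hG.1
  have htight := Literature.MathematicalPhysics.KineticTheory.HeatConduction.oneSiteTight_of_isShiftInvariant
    (μ := μT) hS
  obtain ⟨_, hss⟩ :=
    OscillatorChain.isShiftInvariant_and_hasSuperstabilityEstimate_of_tight_pinnedChain γ hω hl.le hβ.le hT hG htight
  -- S3 at the regular pair
  have hS3 := fixedFrequencyMatching_of_registeredLeaves stub_uniformAnchoredCorrelationTails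
    stub_uniformFixedTimeOffsetMatching ω₂ lam β γ hω hl hβ hγ T hT
    (stub_regularDLRUnique ω₂ lam β γ hω hl hβ hγ T hT) μT D hG hS hss hcar hP hAC
  obtain ⟨a, ha, ν₀, hν₀, hAν⟩ := hA ω₂ lam β γ hω hl hβ hγ T hT
  refine ⟨μT, D, a, ν₀, hG, hS, hP, hAC, ha, hν₀, fun ν hν hlt => ?_⟩
  obtain ⟨N₀, hN₀⟩ := hAν ν hν hlt
  refine ge_of_tendsto (hS3 ν hν) ?_
  filter_upwards [eventually_ge_atTop (max N₀ 1)] with N hN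
  have hN0 : N₀ ≤ N := le_trans (le_max_left _ _) hN
  have hN1 : 1 ≤ N := le_trans (le_max_right _ _) hN
  have hNpos : (0:ℝ) < N := by exact_mod_cast hN1
  rw [le_div_iff₀ hNpos]
  exact hN₀ N hN0

/-- **(A⁻) ↔ W: the registered stub `stub_openChainAbelFloor` IS the shift-invariant bulk Abel floor.**  (`←` is the landed bridge
`abelFloor_openChain_of_bulkWitness`, `→` is `bulkAbelFloorWitness_of_abelFloor_openChain`.)  In words: an `N`-uniform
fixed-frequency floor of the OPEN chains' Abel-regularised Green–Kubo integral per unit length holds iff the equilibrium bulk (the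
infinite shift-invariant Gibbs chain) is not Abel-insulating — its energy spread is at least diffusive in Abel mean.
[cite: BonettoLebowitzReyBellet2000, §7 eq. (37)] -/
theorem abelFloor_openChain_iff_bulkAbelFloorWitness :
    (∀ ω₂ lam β γ : ℝ, 0 < ω₂ → 0 < lam → 0 < β → 0 < γ → ∀ T : ℝ, 0 < T →
      ∃ a : ℝ, 0 < a ∧ ∃ ν₀ : ℝ, 0 < ν₀ ∧ ∀ ν : ℝ, 0 < ν → ν < ν₀ → ∃ N₀ : ℕ, ∀ N : ℕ, N₀ ≤ N →
        a * N ≤ ∫ t in Set.Ioi (0:ℝ), Real.exp (-(ν * t)) *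
          ∫ z, (∑ i : Fin N, (pinnedChain ω₂ lam β γ).bondCurrent N i z) *
            (∫ y, (∑ i : Fin N, (pinnedChain ω₂ lam β γ).bondCurrent N i y)
              ∂((pinnedChain ω₂ lam β γ).transitionKernel N T T t.toNNReal z))
            ∂((pinnedChain ω₂ lam β γ).gibbsMeasure N T)) ↔
    (∀ ω₂ lam β γ : ℝ, 0 < ω₂ → 0 < lam → 0 < β → 0 < γ → ∀ T : ℝ, 0 < T →
      ∃ (μT : Measure ChainConfig) (D : InfiniteChainDynamics (pinnedChain ω₂ lam β γ)) (a ν₀ : ℝ),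
        (pinnedChain ω₂ lam β γ).IsChainGibbsMeasure T μT ∧ IsShiftInvariant μT ∧
        D.PreservesMeasure μT ∧ (∀ t : ℝ, D.HasAbsConvergentCorrelation μT t) ∧ 0 < a ∧ 0 < ν₀ ∧
        ∀ ν : ℝ, 0 < ν → ν < ν₀ →
          a ≤ ∫ t in Set.Ioi (0:ℝ), Real.exp (-(ν * t)) * D.currentCorrelation μT t) :=
  ⟨bulkAbelFloorWitness_of_abelFloor_openChain, abelFloor_openChain_of_bulkWitness⟩

/-! ## §3 Under (R) the crux is exactly W -/

/-- **Under (R) = `UniformAbelianRegularity` (stmt-13416): `ConductanceLowerBound ↔ W`.**  `→`: necessity of (A⁻) (§1) then (A⁻) → W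
(§2); `←`: the landed composition of the line (W → (A⁻), (R) → (R⁻), (A⁻) → (R⁻) → crux; p156938; the `StaticAbelianSqueeze` and
`JunctionLocality` copies of the decl are definitionally equal).  So on every route carrying the sibling stmt-13416 the shared child
stmt-11749 is EXACTLY the shift-invariant bulk Abel floor. [cite: KunduDharNarayan2009, p. 3] -/
theorem conductanceLowerBound_iff_bulkAbelFloorWitness_of_uniformAbelianRegularity
    (hR : Summit.AtomisticToContinuum.FouriersLaw.Theses.StaticAbelianSqueeze.UniformAbelianRegularity) :
    Summit.AtomisticToContinuum.FouriersLaw.Theses.JunctionLocality.ConductanceLowerBound ↔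
    (∀ ω₂ lam β γ : ℝ, 0 < ω₂ → 0 < lam → 0 < β → 0 < γ → ∀ T : ℝ, 0 < T →
      ∃ (μT : Measure ChainConfig) (D : InfiniteChainDynamics (pinnedChain ω₂ lam β γ)) (a ν₀ : ℝ),
        (pinnedChain ω₂ lam β γ).IsChainGibbsMeasure T μT ∧ IsShiftInvariant μT ∧
        D.PreservesMeasure μT ∧ (∀ t : ℝ, D.HasAbsConvergentCorrelation μT t) ∧ 0 < a ∧ 0 < ν₀ ∧
        ∀ ν : ℝ, 0 < ν → ν < ν₀ →
          a ≤ ∫ t in Set.Ioi (0:ℝ), Real.exp (-(ν * t)) * D.currentCorrelation μT t) :=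
  ⟨fun hC => bulkAbelFloorWitness_of_abelFloor_openChain
      (abelFloor_openChain_of_conductanceLowerBound_of_uniformAbelianRegularity hR hC),
    fun hW => conductanceLowerBound_of_abelFloor_and_signedSlowRegularity (abelFloor_openChain_of_bulkWitness hW)
      (slowRegularity_signed_of_uniformAbelianRegularity hR)⟩

end Summit.AtomisticToContinuum.FouriersLaw.Cruxes.ConductanceLowerBound.AbelFloorExchange

end
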